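/-
Copyright (c) 2026 the pub-hodgecm-mathlib formalisation cell (harness21).  Prover seat hodgecm-mathlib-B-p14 (g42): the consumer-facing API of the wild quadratic layer
(LH4-plan (g4) WORD #1 «FILE 8 ALL-`d` API»; census F0P3a-p06 (g17) `DUNR-H2-CENSUS.md` §3, mechanisms M3∕M4∕M6); 2026-09-02.
-/
import Literature.NumberTheory.LocalFields.WildQuadraticNormIndexTwoAll   -- ★ the norm index theorem + (C4); brings the whole ★ wild quadratic layer
import HarnessLib

/-!
# Wild quadratic norms — the ALL-`d` API: for EVERY non-square `d` of a complete dyadic field, INDEX TWO (`K^× = N_d ⊔ c·N_d`) and the CONDUCTOR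
# `f(K(√d)∕K) ∈ {0, 2e+1−s, 2e+1}` read on the unit filtration, with its value class by class

Topic `NumberTheory/LocalFields`; namespace `Literature.NumberTheory.LocalFields`.  THEOREMS ONLY (no definition, no instance, no notation, no named fact, no `sorry`);
CM-free; kernel lane `--supports stmt-HodgeConjecture-24833`.  Cell `pub/hodgecm-mathlib` (D-0151), crux H413 = `stmt-HodgeConjecture-24833`; half A line LH4, DYADIC
pay-down leaf `Cruxes/H413/Lines/F0_P3c_DyadicPaydown.lean`, organs (D-UNR)∕(D-RAM) (PRINT this week; census F0P3a-p06 (g17) OUTCOME B: the transfer-factor exponent (M3),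
the self-dual lattice laws (M4) and the Euler–Poincaré relation (M6) on the WILD type-(2) tori `T = Res¹ L_w(√d)^×` key on the conductor `f(L_w(√d)∕L_w)` and on the norm
group `N_d`).  Eighth (consumer) file of the wild quadratic layer ★ `WildQuadraticNormsNearOne` · `…Exactness` · `…Descent` · `…IndexTwo` · `…UnitConductor` ·
`…UnitIndexTwo` · `…IndexTwoAll`; no new mathematics — the layer's theorems in the shape a torus-side consumer quantifies over («for every non-square `d`», no normal
form).  Currency (define-free, as the layer): `Valued.v : K → ℤᵐ⁰`; «`N_d x`» := `∃ a b : K, a·a − d·(b·b) = x`; «non-square» := `∀ r, r·r ≠ d`; the unit filtration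
`U^{(f)} = {x : v x = 1 ∧ v(x − 1) ≤ exp(−f)}` (the clause `v x = 1` matters for `f = 0` only); uniformiser binder `hϖ : v ϖ = exp(−1)`; `e = ord 2`, `v(4ϖ) = exp(−(2e+1))`.
HONEST LABEL: HC_CM is proved only modulo the 7 printed citations (2 remaining named inputs: hLiu418 = stmt-HodgeConjecture-24832, h413 = stmt-HodgeConjecture-24833) until rung 0
closes; count-neutral, Mathlib-footed, bankable.

* (i) `norm_index_two_of_forall_mul_self_ne` — `∃ c ≠ 0, c ∉ N_d ∧ (∀ x ≠ 0, x ∈ N_d ∨ x·c ∈ N_d) ∧ (∀ x ≠ 0, ¬(x ∈ N_d ∧ x·c ∈ N_d))` (★ norm index theorem + `N_d` a group).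
* (ii-0) `normGroup_of_valued_sub_one_le_four` — the UNRAMIFIED class `v(d − 1) ≤ v 4` (`d` non-square): every unit is a norm (`f = 0`, ★ (W3)) and
  `x ∈ N_d ⟺ v x` is a square value (★ `exists_sq_sub_delta_mul_sq_iff_valued_eq_sq`; `η̄ ∉ ℘` because `d` is not a square, ★ (X5 ⇐)).
* (ii-odd) `conductor_of_valued_odd` — ODD ORDER: `U^{(2e+1)} = {v(x − 1) < v 4} ⊆ N_d` (★ (W1)) and a unit `x` with `v(x − 1) = v 4` outside `N_d` (★ (X4)+(X6)): `f = 2e + 1`.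
* (ii-defect) `conductor_one_add_of_odd_defect` — UNIT OF ODD DEFECT `d = 1 + w`, `v 4 < v w < 1`, `v w` odd: `{v(w(x − 1)) < v 4} ⊆ N_d` (★ (C1)) and a unit `x` with
  `v(w(x − 1)) = v 4` outside (★ (C2)+(X6)): `f = 2e + 1 − s`, `s = ord w`.
* (ii) `conductor_exists_of_forall_mul_self_ne` — for EVERY non-square `d`: `∃ f : ℕ` with `v(4ϖ) ≤ exp(−f)` (`f ≤ 2e + 1`), `U^{(f)} ⊆ N_d`, and `f = 0` or a unit of depth
  EXACTLY `exp(−(f − 1))` outside `N_d` — the least `f` with `U^{(f)} ⊆ N_d`, i.e. the Artin conductor of the quadratic character of `K(√d)∕K` [Serre XV §2] — assembled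
  from (C4) ★ `exists_unit_mul_sq_depth_dichotomy` and (ii-0∕odd∕defect) along ★ `exists_sq_sub_mul_sq_iff_mul_sq`.
* (ii′) `conductor_iff_of_forall_mul_self_ne` — `U^{(k)} ⊆ N_d ⟺ f ≤ k` for every `k` (the least-index form).
* `…_adicCompletion` dresses of (i) and (ii) for a number field `F` at a dyadic place `v` (`v(2) < 1`).

## References
* [Serre1979] J.-P. Serre, *Local Fields*, GTM 67 (1979), Ch. XV §2 (norm groups, conductor of an abelian extension via `U_K^{(n)}`); Ch. XIV §§3–4.
* [Omeara1963] O. T. O'Meara, *Introduction to Quadratic Forms*, Grundlehren 117 (1963), §63A 63:2–63:5, §63B 63:9–63:11a (held copy p. 163–170).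
* [NeukirchANT1999] J. Neukirch, *Algebraic Number Theory* (1999), Ch. V (1.3), Ch. V §3.
-/

set_option autoImplicit false

noncomputable section

open scoped Valued WithZero
open WithZero NumberField IsDedekindDomain

namespace Literature.NumberTheory.LocalFields

section API
variable {K : Type*} [Field K] [Valued K ℤᵐ⁰]

/-- **(i) INDEX TWO, consumer shape**: `K` complete with finite residue field, `2 ≠ 0`, `v 2 < 1`, uniformiser `ϖ`; `d ≠ 0` not a square.  Then there is `c ≠ 0` with
`c ∉ N(K(√d)^×)`, `∀ x ≠ 0, x ∈ N ∨ x·c ∈ N`, and never both (`N` is a group: ★ Brahmagupta ∕ `…_eq_inv`) — `K^× = N ⊔ cN`, `[K^× : N(K(√d)^×)] = 2`.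
[cite: NeukirchANT1999, Ch. V (1.3)] [cite: Omeara1963, §63B 63:9–63:11a] [cite: Serre1979, Ch. XV §2] -/
theorem norm_index_two_of_forall_mul_self_ne [IsAdicComplete 𝓂[K] 𝒪[K]] [Finite 𝓀[K]] (h2 : (2 : K) ≠ 0) (h2v : Valued.v (2 : K) < 1)
    {ϖ : K} (hϖ : Valued.v ϖ = exp (-1 : ℤ)) {d : K} (hd0 : d ≠ 0) (hns : ∀ r : K, r * r ≠ d) :
    ∃ c : K, c ≠ 0 ∧ (¬ ∃ a b : K, a * a - d * (b * b) = c) ∧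
      (∀ x : K, x ≠ 0 → (∃ a b : K, a * a - d * (b * b) = x) ∨ (∃ a b : K, a * a - d * (b * b) = x * c)) ∧
      ∀ x : K, x ≠ 0 → ¬ ((∃ a b : K, a * a - d * (b * b) = x) ∧ (∃ a b : K, a * a - d * (b * b) = x * c)) := by
  obtain ⟨c, hc, hall⟩ := exists_nonnorm_dichotomy_of_forall_mul_self_ne h2 h2v hϖ hd0 hns
  refine ⟨c, ?_, hc, hall, fun x hx0 h => hc ?_⟩
  · rintro rfl
    exact hc ⟨0, 0, by ring⟩
  · have h' := exists_sq_sub_mul_sq_eq_mul d h.2 (exists_sq_sub_mul_sq_eq_inv d h.1)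
    rwa [show x * c * x⁻¹ = c by field_simp] at h'

/-- **(ii-0) THE UNRAMIFIED CLASS** (`f = 0`): `K` complete with finite residue field, `2 ≠ 0`, `v 2 < 1`; `d` with `v(d − 1) ≤ v 4` and `d` NOT a square.  Then every UNIT is a
norm from `K(√d)` (★ (W3)), and for `x ≠ 0`: `x ∈ N(K(√d)^×) ⟺ v x` is a square value `v y·v y` (even order) — with `η = (d − 1)∕4`, `η̄ ∉ ℘(𝓀)` because `d` is not a
square (★ (X5 ⇐)), so `d` is the `Δ`-class and ★ `exists_sq_sub_delta_mul_sq_iff_valued_eq_sq` applies. [cite: Omeara1963, §63A 63:3; §63B 63:11a] [cite: Serre1979, Ch. XV §2] -/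
theorem normGroup_of_valued_sub_one_le_four [IsAdicComplete 𝓂[K] 𝒪[K]] [Finite 𝓀[K]] (h2 : (2 : K) ≠ 0) (h2v : Valued.v (2 : K) < 1)
    {d : K} (hd : Valued.v (d - 1) ≤ Valued.v (4 : K)) (hns : ∀ r : K, r * r ≠ d) :
    (∀ x : K, Valued.v x = 1 → ∃ a b : K, a * a - d * (b * b) = x) ∧
      ∀ x : K, x ≠ 0 → ((∃ a b : K, a * a - d * (b * b) = x) ↔ ∃ y : K, Valued.v x = Valued.v y * Valued.v y) := by
  have hres := exists_valued_mul_self_sub_lt_one_of_finite_residueField (K := K) h2v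
  refine ⟨fun x hx => exists_sq_sub_mul_sq_eq_of_valued_eq_one_of_finite_residueField h2 h2v hd hx, fun x hx0 => ?_⟩
  have h40 : (4 : K) ≠ 0 := by
    rw [show (4 : K) = 2 * 2 by norm_num]
    exact mul_ne_zero h2 h2
  have hv40 : Valued.v (4 : K) ≠ 0 := (Valuation.ne_zero_iff _).2 h40
  set η : K := (d - 1) * (4 : K)⁻¹ with hη
  clear_value η
  have hdη : d = 1 + 4 * η := by
    rw [hη]
    field_simp
    ring
  have hη1 : Valued.v η ≤ 1 := by
    rw [hη, map_mul, map_inv₀]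
    calc Valued.v (d - 1) * (Valued.v (4 : K))⁻¹ ≤ Valued.v (4 : K) * (Valued.v (4 : K))⁻¹ := mul_le_mul_left hd _
      _ = 1 := mul_inv_cancel₀ hv40
  have hηAS : ∀ ρ : K, Valued.v ρ ≤ 1 → 1 ≤ Valued.v (ρ * ρ + ρ - η) := by
    intro ρ hρ1
    by_contra hlt
    rw [not_le] at hlt
    obtain ⟨r, hr⟩ := exists_mul_self_eq_one_add_four_mul h2v hρ1 hlt
    exact hns r (by rw [hr, hdη])
  rw [hdη]
  exact exists_sq_sub_delta_mul_sq_iff_valued_eq_sq h2 h2v hres hη1 hηAS hx0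

/-- **(ii-odd) ODD ORDER** (`f = 2e + 1`): `K` complete with finite residue field, `2 ≠ 0`, `v 2 < 1`; `v d` not a square value.  Then `U^{(2e+1)} = {v(x − 1) < v 4} ⊆ N(K(√d)^×)`
(★ (W1)) and some unit `x` with `v(x − 1) = v 4` — depth exactly `2e` — is NOT a norm (`x = 1 + 4η`, `η̄ ∉ ℘(𝓀)`: ★ (X6) + ★ (X4)).  The conductor is `2e + 1`.
[cite: Omeara1963, §63B 63:11a] [cite: Serre1979, Ch. XIV §4; Ch. XV §2] -/
theorem conductor_of_valued_odd [IsAdicComplete 𝓂[K] 𝒪[K]] [Finite 𝓀[K]] (h2 : (2 : K) ≠ 0) (h2v : Valued.v (2 : K) < 1)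
    {d : K} (hd : ∀ y : K, Valued.v d ≠ Valued.v y * Valued.v y) :
    (∀ x : K, Valued.v (x - 1) < Valued.v (4 : K) → ∃ a b : K, a * a - d * (b * b) = x) ∧
      ∃ x : K, Valued.v x = 1 ∧ Valued.v (x - 1) = Valued.v (4 : K) ∧ ¬ ∃ a b : K, a * a - d * (b * b) = x := by
  refine ⟨fun x hx => exists_sq_sub_mul_sq_eq_of_valued_sub_one_lt_four d x hx, ?_⟩
  obtain ⟨η, hη1, hη⟩ := exists_forall_one_le_valued_artinSchreier_sub (K := K) h2v
  have hηu : Valued.v η = 1 := valued_eq_one_of_forall_one_le_valued_artinSchreier_sub hη1 hη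
  have hv4lt : Valued.v (4 : K) < 1 := by
    rw [show (4 : K) = 2 * 2 by norm_num, map_mul]
    exact mul_lt_one' h2v h2v
  have h4η : Valued.v (4 * η) = Valued.v (4 : K) := by rw [map_mul, hηu, mul_one]
  refine ⟨1 + 4 * η, Valuation.map_one_add_of_lt _ (by rw [h4η]; exact hv4lt), by rw [add_sub_cancel_left, h4η],
    not_exists_sq_sub_mul_sq_eq_one_add_four_mul h2 hd hη1 hη⟩

/-- **(ii-defect) UNIT OF ODD DEFECT** (`f = 2e + 1 − s`): `K` complete with finite residue field, `2 ≠ 0`, `v 2 < 1`; `d = 1 + w` with `v 4 < v w < 1` and `v w` not a square value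
(`ord w = s` odd).  Then `{x : v(w·(x − 1)) < v 4} ⊆ N(K(√(1+w))^×)` — the units of depth `≥ 2e + 1 − s` — (★ (C1)) and some unit `x` with `v(w·(x − 1)) = v 4` — depth EXACTLY
`2e − s` — is NOT a norm (`x = 1 + 4η∕w`: ★ (X6) + ★ (C2)).  The conductor is `2e + 1 − s`. [cite: Omeara1963, §63B 63:11a] [cite: Serre1979, Ch. XIV §4; Ch. XV §2] -/
theorem conductor_one_add_of_odd_defect [IsAdicComplete 𝓂[K] 𝒪[K]] [Finite 𝓀[K]] (h2 : (2 : K) ≠ 0) (h2v : Valued.v (2 : K) < 1)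
    {w : K} (hw1 : Valued.v w < 1) (h4w : Valued.v (4 : K) < Valued.v w) (hwodd : ∀ y : K, Valued.v w ≠ Valued.v y * Valued.v y) :
    (∀ x : K, Valued.v (w * (x - 1)) < Valued.v (4 : K) → ∃ a b : K, a * a - (1 + w) * (b * b) = x) ∧
      ∃ x : K, Valued.v x = 1 ∧ Valued.v (w * (x - 1)) = Valued.v (4 : K) ∧ ¬ ∃ a b : K, a * a - (1 + w) * (b * b) = x := by
  refine ⟨fun x hx => exists_sq_sub_one_add_mul_sq_eq_of_valued_mul_lt_four h2 hw1 hx, ?_⟩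
  obtain ⟨η, hη1, hη⟩ := exists_forall_one_le_valued_artinSchreier_sub (K := K) h2v
  have hηu : Valued.v η = 1 := valued_eq_one_of_forall_one_le_valued_artinSchreier_sub hη1 hη
  have hw0 : w ≠ 0 := fun h => hwodd 0 (by rw [h, map_zero, mul_zero])
  have hvw0 : Valued.v w ≠ 0 := (Valuation.ne_zero_iff _).2 hw0
  have h4η : Valued.v (4 * η) = Valued.v (4 : K) := by rw [map_mul, hηu, mul_one]
  have hdepth : Valued.v (w * (1 + 4 * η * w⁻¹ - 1)) = Valued.v (4 : K) := by
    rw [show w * (1 + 4 * η * w⁻¹ - 1) = 4 * η by field_simp; ring, h4η]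
  refine ⟨1 + 4 * η * w⁻¹, Valuation.map_one_add_of_lt _ ?_, hdepth,
    not_exists_sq_sub_one_add_mul_sq_eq_one_add_four_mul_mul_inv h2 h2v hw1 h4w hwodd hη1 hη⟩
  rw [map_mul, map_inv₀, h4η]
  calc Valued.v (4 : K) * (Valued.v w)⁻¹ < Valued.v w * (Valued.v w)⁻¹ := mul_lt_mul_of_pos_right h4w (zero_lt_iff.2 (inv_ne_zero hvw0))
    _ = 1 := mul_inv_cancel₀ hvw0

/-- **(ii) THE CONDUCTOR OF `K(√d)∕K` FOR EVERY NON-SQUARE `d`** (define-free Artin conductor on the unit filtration `U^{(f)} = {v x = 1, v(x − 1) ≤ exp(−f)}`): `K` complete with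
finite residue field, `2 ≠ 0`, `v 2 < 1`, uniformiser `ϖ`; `d ≠ 0` not a square.  There is `f : ℕ` with `v(4ϖ) ≤ exp(−f)` (`f ≤ 2e + 1`), `U^{(f)} ⊆ N(K(√d)^×)`, and EITHER
`f = 0` OR some unit of depth exactly `exp(−(f − 1))` is not a norm — so `f` is the least index with `U^{(f)} ⊆ N`.  Its value: `0` on the `Δ`-class (ii-0), `2e + 1 − s` for a
unit of odd defect `s` (ii-defect), `2e + 1` for odd order (ii-odd); assembled along (C4) ★ `exists_unit_mul_sq_depth_dichotomy` and ★ square-class transport.  `f` IS the Artin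
conductor exponent `a(χ_d)` of the quadratic character of `K(√d)∕K` — equivalently `v(𝔡_{K(√d)∕K})` by the conductor–discriminant formula for a quadratic extension — i.e. the
invariant the DUNR-H2-CENSUS (F0P3a-p06 (g17)) mechanisms M3∕M4∕M6 call the wild conductor `a(K₂∕L_w)`; value table `0 ∕ 2e+1−s ∕ 2e+1` for the `4𝒪`-defect ∕ odd-defect-`s` ∕
odd-order classes.
[cite: Serre1979, Ch. XV §2] [cite: Omeara1963, §63A 63:2; §63B 63:11a] [cite: NeukirchANT1999, Ch. V (1.3)] -/
theorem conductor_exists_of_forall_mul_self_ne [IsAdicComplete 𝓂[K] 𝒪[K]] [Finite 𝓀[K]] (h2 : (2 : K) ≠ 0) (h2v : Valued.v (2 : K) < 1)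
    {ϖ : K} (hϖ : Valued.v ϖ = exp (-1 : ℤ)) {d : K} (hd0 : d ≠ 0) (hns : ∀ r : K, r * r ≠ d) :
    ∃ f : ℕ, Valued.v ((4 : K) * ϖ) ≤ exp (-(f : ℤ)) ∧
      (∀ x : K, Valued.v x = 1 → Valued.v (x - 1) ≤ exp (-(f : ℤ)) → ∃ a b : K, a * a - d * (b * b) = x) ∧
      (f = 0 ∨ ∃ x : K, Valued.v x = 1 ∧ Valued.v (x - 1) = exp (-((f : ℤ) - 1)) ∧ ¬ ∃ a b : K, a * a - d * (b * b) = x) := by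
  have hres := exists_valued_mul_self_sub_lt_one_of_finite_residueField (K := K) h2v
  obtain ⟨e, he1, he⟩ := exists_valued_two_eq_exp_nat h2 h2v
  have hϖ0 : ϖ ≠ 0 := (Valuation.ne_zero_iff _).1 (by rw [hϖ]; exact exp_ne_zero)
  have hvd0 : Valued.v d ≠ 0 := (Valuation.ne_zero_iff _).2 hd0
  have hv4 : Valued.v (4 : K) = exp (-(2 * (e : ℤ))) := by
    rw [show (4 : K) = 2 * 2 by norm_num, map_mul, he, ← exp_add, exp_inj]
    ring
  have hv4ϖ : Valued.v ((4 : K) * ϖ) = exp (-(2 * (e : ℤ) + 1)) := by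
    rw [map_mul, hv4, hϖ, ← exp_add, exp_inj]
    ring
  rcases Int.even_or_odd (log (Valued.v d)) with ⟨r, hr⟩ | ⟨j, hj⟩
  · -- even order: transport to the unit `d₁ = d·(ϖ^r)²`, then (C4)
    have hs0 : ϖ ^ r ≠ 0 := zpow_ne_zero _ hϖ0
    have hunit : Valued.v (d * (ϖ ^ r * ϖ ^ r)) = 1 := by
      rw [map_mul, map_mul, valued_uniformizer_zpow hϖ, ← exp_log hvd0, hr, ← exp_add, ← exp_add, ← exp_zero, exp_inj]
      ring
    obtain ⟨t, ht, hdich⟩ := exists_unit_mul_sq_depth_dichotomy h2 h2v hres hϖ hunit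
    have ht0 : t ≠ 0 := (Valuation.ne_zero_iff _).1 (by rw [ht]; exact one_ne_zero)
    -- `N_d = N_z` for `z = d (ϖ^r)² t²`
    have htr : ∀ x : K, (∃ a b : K, a * a - d * (b * b) = x) ↔ ∃ a b : K, a * a - d * (ϖ ^ r * ϖ ^ r) * (t * t) * (b * b) = x :=
      fun x => (exists_sq_sub_mul_sq_iff_mul_sq d hs0 x).trans (exists_sq_sub_mul_sq_iff_mul_sq _ ht0 x)
    set z : K := d * (ϖ ^ r * ϖ ^ r) * (t * t) with hz
    clear_value z
    have hzns : ∀ r' : K, r' * r' ≠ z := by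
      intro r' hr'
      refine hns (r' * (ϖ ^ r * t)⁻¹) ?_
      have hne : ϖ ^ r * t ≠ 0 := mul_ne_zero hs0 ht0
      rw [hz] at hr'
      field_simp
      linear_combination hr'
    rcases hdich with hdeep | ⟨h4z, hz1, hzodd⟩
    · -- the `Δ`-class: `f = 0`
      refine ⟨0, by rw [Nat.cast_zero, neg_zero, exp_zero]; exact le_of_lt (by rw [hv4ϖ, ← exp_zero, exp_lt_exp]; omega), fun x hx _ => ?_, Or.inl rfl⟩
      exact (htr x).2 ((normGroup_of_valued_sub_one_le_four h2 h2v hdeep hzns).1 x hx)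
    · -- odd defect `s`: `f = 2e + 1 − s`
      have hw0 : Valued.v (z - 1) ≠ 0 := fun h => hzodd 0 (by rw [h, map_zero, mul_zero])
      obtain ⟨s, hs⟩ : ∃ s : ℕ, log (Valued.v (z - 1)) = -(s : ℤ) := by
        refine Int.exists_eq_neg_ofNat ?_
        rw [← exp_le_exp, exp_log hw0, exp_zero]
        exact hz1.le
      have hws : Valued.v (z - 1) = exp (-(s : ℤ)) := by rw [← hs, exp_log hw0]
      have hs1 : 1 ≤ s ∧ s + 1 ≤ 2 * e := by
        have h1 := hz1
        have h2' := h4z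
        rw [hws, ← exp_zero, exp_lt_exp] at h1
        rw [hws, hv4, exp_lt_exp] at h2'
        omega
      obtain ⟨hC1, x, hx1, hxd, hxN⟩ := conductor_one_add_of_odd_defect h2 h2v hz1 h4z hzodd
      have hz' : 1 + (z - 1) = z := by ring
      refine ⟨2 * e + 1 - s, ?_, fun y hy hyd => ?_, Or.inr ⟨x, hx1, ?_, fun h => hxN ?_⟩⟩
      · rw [hv4ϖ, exp_le_exp]
        omega
      · refine (htr y).2 ?_
        rw [← hz']
        refine hC1 y ?_
        rw [map_mul, hws, hv4]
        calc exp (-(s : ℤ)) * Valued.v (y - 1) ≤ exp (-(s : ℤ)) * exp (-((2 * e + 1 - s : ℕ) : ℤ)) := mul_le_mul_right hyd _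
          _ < exp (-(2 * (e : ℤ))) := by
              rw [← exp_add, exp_lt_exp]
              push_cast [show s ≤ 2 * e + 1 by omega]
              omega
      · have h := hxd
        rw [map_mul, hws, hv4] at h
        have hx0 : Valued.v (x - 1) ≠ 0 := by
          intro h0
          rw [h0, mul_zero] at h
          exact exp_ne_zero h.symm
        rw [← exp_log hx0, ← exp_add, exp_inj] at h
        rw [← exp_log hx0, exp_inj]
        push_cast [show s ≤ 2 * e + 1 by omega]
        omega
      · rw [← hz'] at htr
        exact (htr x).1 h
  · -- odd order: `f = 2e + 1`
    have hdodd : ∀ y : K, Valued.v d ≠ Valued.v y * Valued.v y :=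
      valued_ne_mul_self_of_eq_exp_odd (n := j) (by rw [← exp_log hvd0, hj])
    obtain ⟨hW1, x, hx1, hxd, hxN⟩ := conductor_of_valued_odd h2 h2v hdodd
    refine ⟨2 * e + 1, by rw [hv4ϖ]; push_cast; exact le_rfl, fun y _ hyd => hW1 y ?_, Or.inr ⟨x, hx1, ?_, hxN⟩⟩
    · refine hyd.trans_lt ?_
      rw [hv4, exp_lt_exp]
      push_cast
      omega
    · rw [hxd, hv4]
      congr 1
      push_cast
      ring

/-- **(ii′) THE CONDUCTOR AS THE LEAST FILTRATION INDEX** (consumer form for the conductor-indexed orders of M4): with `f` as in `conductor_exists_of_forall_mul_self_ne`, for every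
`k : ℕ`, `U^{(k)} ⊆ N(K(√d)^×) ⟺ f ≤ k` (monotone filtration + the sharp witness at depth `f − 1`). [cite: Serre1979, Ch. XV §2] -/
theorem conductor_iff_of_forall_mul_self_ne [IsAdicComplete 𝓂[K] 𝒪[K]] [Finite 𝓀[K]] (h2 : (2 : K) ≠ 0) (h2v : Valued.v (2 : K) < 1)
    {ϖ : K} (hϖ : Valued.v ϖ = exp (-1 : ℤ)) {d : K} (hd0 : d ≠ 0) (hns : ∀ r : K, r * r ≠ d) :
    ∃ f : ℕ, Valued.v ((4 : K) * ϖ) ≤ exp (-(f : ℤ)) ∧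
      ∀ k : ℕ, (∀ x : K, Valued.v x = 1 → Valued.v (x - 1) ≤ exp (-(k : ℤ)) → ∃ a b : K, a * a - d * (b * b) = x) ↔ f ≤ k := by
  obtain ⟨f, hfb, hN, hmin⟩ := conductor_exists_of_forall_mul_self_ne h2 h2v hϖ hd0 hns
  refine ⟨f, hfb, fun k => ⟨fun hk => ?_, fun hfk x hx hxk => hN x hx (hxk.trans (by rw [exp_le_exp]; omega))⟩⟩
  by_contra hlt
  rw [not_le] at hlt
  rcases hmin with hf0 | ⟨x, hx1, hxd, hxN⟩
  · omega
  · exact hxN (hk x hx1 (by rw [hxd, exp_le_exp]; omega))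

end API

/-! ## The completion `F_v` of a number field at a dyadic place -/
section AdicCompletion
variable (F : Type*) [Field F] [NumberField F] (v : HeightOneSpectrum (𝓞 F))

/-- **(i) INDEX TWO IN `F_v`** (dyadic place: `v(2) < 1`; uniformiser binder; `d ≠ 0` not a square): `∃ c ≠ 0, c ∉ N(F_v(√d)^×) ∧ (∀ x ≠ 0, x ∈ N ∨ x·c ∈ N) ∧ (never both)`.
[cite: NeukirchANT1999, Ch. V (1.3)] [cite: Serre1979, Ch. XV §2] -/
theorem norm_index_two_adicCompletion (h2v : Valued.v (2 : v.adicCompletion F) < 1) {ϖ : v.adicCompletion F} (hϖ : Valued.v ϖ = exp (-1 : ℤ))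
    {d : v.adicCompletion F} (hd0 : d ≠ 0) (hns : ∀ r : v.adicCompletion F, r * r ≠ d) :
    ∃ c : v.adicCompletion F, c ≠ 0 ∧ (¬ ∃ a b : v.adicCompletion F, a * a - d * (b * b) = c) ∧
      (∀ x : v.adicCompletion F, x ≠ 0 → (∃ a b : v.adicCompletion F, a * a - d * (b * b) = x) ∨ (∃ a b : v.adicCompletion F, a * a - d * (b * b) = x * c)) ∧
      ∀ x : v.adicCompletion F, x ≠ 0 → ¬ ((∃ a b : v.adicCompletion F, a * a - d * (b * b) = x) ∧ (∃ a b : v.adicCompletion F, a * a - d * (b * b) = x * c)) := by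
  haveI := Literature.NumberTheory.Automorphic.isAdicComplete_valuedMaximalIdeal_valuedInteger_adicCompletion F v
  haveI : Finite 𝓀[v.adicCompletion F] := Literature.NumberTheory.Automorphic.finite_residueField_adicCompletion F v
  have h2 : (2 : v.adicCompletion F) ≠ 0 := by
    rw [show (2 : v.adicCompletion F) = algebraMap F (v.adicCompletion F) 2 by rw [map_ofNat]]
    exact (_root_.map_ne_zero (algebraMap F (v.adicCompletion F))).2 two_ne_zero
  exact norm_index_two_of_forall_mul_self_ne h2 h2v hϖ hd0 hns

/-- **(ii) THE CONDUCTOR IN `F_v`** (dyadic place; uniformiser binder; `d ≠ 0` not a square): `∃ f : ℕ`, `f ≤ 2·ord_v 2 + 1` (as `v(4ϖ) ≤ exp(−f)`), `U^{(f)} ⊆ N(F_v(√d)^×)`, and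
`f = 0` or a unit of depth exactly `exp(−(f−1))` outside `N` — the conductor of `F_v(√d)∕F_v`, values `0 ∕ 2e+1−s ∕ 2e+1` by class. [cite: Serre1979, Ch. XV §2]
[cite: NeukirchANT1999, Ch. V (1.3)] -/
theorem conductor_exists_adicCompletion (h2v : Valued.v (2 : v.adicCompletion F) < 1) {ϖ : v.adicCompletion F} (hϖ : Valued.v ϖ = exp (-1 : ℤ))
    {d : v.adicCompletion F} (hd0 : d ≠ 0) (hns : ∀ r : v.adicCompletion F, r * r ≠ d) :
    ∃ f : ℕ, Valued.v ((4 : v.adicCompletion F) * ϖ) ≤ exp (-(f : ℤ)) ∧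
      (∀ x : v.adicCompletion F, Valued.v x = 1 → Valued.v (x - 1) ≤ exp (-(f : ℤ)) → ∃ a b : v.adicCompletion F, a * a - d * (b * b) = x) ∧
      (f = 0 ∨ ∃ x : v.adicCompletion F, Valued.v x = 1 ∧ Valued.v (x - 1) = exp (-((f : ℤ) - 1)) ∧
        ¬ ∃ a b : v.adicCompletion F, a * a - d * (b * b) = x) := by
  haveI := Literature.NumberTheory.Automorphic.isAdicComplete_valuedMaximalIdeal_valuedInteger_adicCompletion F v
  haveI : Finite 𝓀[v.adicCompletion F] := Literature.NumberTheory.Automorphic.finite_residueField_adicCompletion F v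
  have h2 : (2 : v.adicCompletion F) ≠ 0 := by
    rw [show (2 : v.adicCompletion F) = algebraMap F (v.adicCompletion F) 2 by rw [map_ofNat]]
    exact (_root_.map_ne_zero (algebraMap F (v.adicCompletion F))).2 two_ne_zero
  exact conductor_exists_of_forall_mul_self_ne h2 h2v hϖ hd0 hns

end AdicCompletion

end Literature.NumberTheory.LocalFields

end
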